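import Summits.KontsevichZagierPeriods.KontsevichZagierPeriods.Theorems.HurwitzMicroSectorsNormalFormPrincipleM4KernelRefs
import Summits.KontsevichZagierPeriods.KontsevichZagierPeriods.Theorems.HurwitzMicroSectorsNormalFormPrincipleM4KernelReduceZeta
import Summits.KontsevichZagierPeriods.KontsevichZagierPeriods.Theorems.HurwitzMicroSectorsNormalFormPrincipleM4KernelReduceLog
import Summits.KontsevichZagierPeriods.KontsevichZagierPeriods.Theorems.HurwitzMicroSectorsNormalFormPrincipleLevelOneBoxPolyExistsPt
import Summits.KontsevichZagierPeriods.KontsevichZagierPeriods.Theorems.MzvKernelInKZ.Negative.ScalingDivision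
import Summits.KontsevichZagierPeriods.KontsevichZagierPeriods.Theorems.HyperbolicBlochOffTetraSectorKernelStubAffineOrbit
import Literature.NumberTheory.Transcendental.LindemannWeierstrassProofs

/-!
# `NormalFormPrinciple` (stmt-KontsevichZagierPeriods-3869), line `SketchIdeator1` —
# leaf `stub_boxRigidity`, layer `M4` kernel: the `ζ(4)` families AND the polynomial boxes (Lindemann)

Pure proof file (lead seat c9; `--supports` the crux). An UNCONDITIONAL instance of Conjecture 1 on
an infinite subgroup whose values span the two-dimensional `ℚ`-space `ℚ + ℚπ⁴`: the subgroup
generated by the seven `ζ(4)`-valued dimension-four box families of the kernel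
(`[□⁴, 1/(1∓Π)]`, `[□⁴, 1/((1−xy)(1−Π))]`, `[□⁴, 1/((1−xyz)(1−Π))]`, `[□⁴, 1/((1−xy)(1∓zw))]`,
`[□⁴, 1/((1+xy)(1+zw))]`, `Π = xyzw`) together with ALL rational polynomial boxes `[□ᵐ, p]` of all
dimensions. Every element reduces, after multiplication by `8`, to `α·[ζ(4) box] + [pt, q]`
(`m4k4_reduce_zeta/log` — chains through the level-two relations of the dimension-four campaign;
`LevelOne.boxPoly_exists_pt`); its value is `α ζ(4) + q = α π⁴/90 + q` (`ζ(4) = π⁴/90`, Euler, from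
Mathlib's `riemannZeta_four`); LINDEMANN's theorem (`transcendental_pi_holds`, proved in the tree)
forces `α = 0` (else `π` is a root of `90q + αX⁴ ∈ ℚ[X] ∖ 0`), whence `q = 0`.
References: M. Kontsevich, D. Zagier, *Periods* (2001), §1.2 (Conjecture 1); F. Lindemann (1882).
No definitions are introduced.
-/

noncomputable section

open MeasureTheory Set
open Literature.NumberTheory.Transcendental Literature.NumberTheory.Transcendental.KZ
open Summit.KontsevichZagierPeriods.MzvKernelInKZ.Negative (mem_relations_of_nsmul_mem)
open Summit.KontsevichZagierPeriods.HyperbolicBloch.OffTetraSectorKernel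
  (aff_orbit_of_sub_sum_zsmul_mem_relations)
open Summit.KontsevichZagierPeriods.HurwitzMicroSectors.NormalFormPrinciple.PiBox.Dlog
  (exists_ptCarrier value_pt pt_add_mem_relations pt_zero_mem_relations)
open Summit.KontsevichZagierPeriods.HurwitzMicroSectors.NormalFormPrinciple.PiBox.LevelOne
  (boxPoly_exists_pt)

namespace Summit.KontsevichZagierPeriods.HurwitzMicroSectors.NormalFormPrinciple.PiBox.M3

/-- **`ζ(4) = π⁴/90`** for the real series `zetaValue 4` (Euler; Mathlib `riemannZeta_four` through
`ofReal_zetaValue`). [folklore] -/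
theorem m4l4_zetaValue_four : zetaValue 4 = Real.pi ^ 4 / 90 := by
  have h := ofReal_zetaValue (k := 4) (by norm_num)
  rw [show ((4:ℕ):ℂ) = 4 by norm_num, riemannZeta_four] at h
  exact_mod_cast h

/-- **No rational relation `α π⁴ + 90 q = 0` with `α ≠ 0`** (Lindemann: `π` is transcendental, so it
is not a root of the nonzero rational polynomial `90q + αX⁴`). [cite: Lindemann1882] -/
theorem m4l4_eq_zero_of_mul_pi_pow_four (α : ℤ) (q : ℚ)
    (h : (α : ℝ) * (Real.pi ^ 4 / 90) + q = 0) : α = 0 := by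
  by_contra hα
  apply transcendental_pi_holds
  refine ⟨Polynomial.C (90 * q) + Polynomial.C (α : ℚ) * Polynomial.X ^ 4, fun h0 => hα ?_, ?_⟩
  · have hc := congrArg (fun p : Polynomial ℚ => p.coeff 4) h0
    simp only [Polynomial.coeff_add, Polynomial.coeff_C_mul, Polynomial.coeff_X_pow,
      Polynomial.coeff_C, Polynomial.coeff_zero, if_true] at hc
    norm_num at hc
    exact_mod_cast hc
  · simp only [map_add, map_mul, Polynomial.aeval_C, Polynomial.aeval_X_pow, eq_ratCast]
    push_cast
    linear_combination (90:ℝ) * h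

/-- **Conjecture 1 UNCONDITIONALLY on the `ζ(4)` families together with all rational polynomial
boxes** (lead seat c9, line `SketchIdeator1`, layer `M4`). A formal `ℤ`-combination of
representations of the seven `ζ(4)`-valued dimension-four box families and of polynomial boxes
`[□ᵐ, p]` (`p ∈ ℚ[x]`, any `m`) whose value vanishes is a Kontsevich–Zagier relation; the
transcendental input is Lindemann's theorem. [cite: KontsevichZagier2001, §1.2 Conjecture 1] -/
theorem m4ZetaFourFamiliesPoly_mem_relations_of_eval_eq_zero
    {c : FormalRep}
    (hc : c ∈ AddSubgroup.closure
      ({y : FormalRep | ∃ N : IntegralRep 4, N.domain = {x | ∀ i, x i ∈ Set.Ioo (0:ℝ) 1} ∧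
        EqOn N.integrand (fun x => 1 / (1 - x 0 * x 1 * x 2 * x 3)) N.domain ∧ y = of N} ∪
      {y : FormalRep | ∃ N : IntegralRep 4, N.domain = {x | ∀ i, x i ∈ Set.Ioo (0:ℝ) 1} ∧
        EqOn N.integrand (fun x => 1 / (1 + x 0 * x 1 * x 2 * x 3)) N.domain ∧ y = of N} ∪
      {y : FormalRep | ∃ N : IntegralRep 4, N.domain = {x | ∀ i, x i ∈ Set.Ioo (0:ℝ) 1} ∧
        EqOn N.integrand (fun x => 1 / ((1 - x 0 * x 1) * (1 - x 0 * x 1 * x 2 * x 3))) N.domain ∧ y = of N} ∪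
      {y : FormalRep | ∃ N : IntegralRep 4, N.domain = {x | ∀ i, x i ∈ Set.Ioo (0:ℝ) 1} ∧
        EqOn N.integrand (fun x => 1 / ((1 - x 0 * x 1 * x 2) * (1 - x 0 * x 1 * x 2 * x 3))) N.domain ∧ y = of N} ∪
      {y : FormalRep | ∃ N : IntegralRep 4, N.domain = {x | ∀ i, x i ∈ Set.Ioo (0:ℝ) 1} ∧
        EqOn N.integrand (fun x => 1 / ((1 - x 0 * x 1) * (1 - x 2 * x 3))) N.domain ∧ y = of N} ∪
      {y : FormalRep | ∃ N : IntegralRep 4, N.domain = {x | ∀ i, x i ∈ Set.Ioo (0:ℝ) 1} ∧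
        EqOn N.integrand (fun x => 1 / ((1 - x 0 * x 1) * (1 + x 2 * x 3))) N.domain ∧ y = of N} ∪
      {y : FormalRep | ∃ N : IntegralRep 4, N.domain = {x | ∀ i, x i ∈ Set.Ioo (0:ℝ) 1} ∧
        EqOn N.integrand (fun x => 1 / ((1 + x 0 * x 1) * (1 + x 2 * x 3))) N.domain ∧ y = of N} ∪
      {y : FormalRep | ∃ (m : ℕ) (p : MvPolynomial (Fin m) ℚ) (N : IntegralRep m),
        N.domain = {x | ∀ i, x i ∈ Set.Ioo (0:ℝ) 1} ∧
        EqOn N.integrand (fun x => (MvPolynomial.aeval x p : ℝ)) N.domain ∧ y = of N}))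
    (hv : eval c = 0) : c ∈ relations := by
  obtain ⟨Z4, C1, Z3, hZ4d, hZ4i, hZ4v, hC1d, hC1i, hZ3d, hZ3i, -⟩ := m4r4_exists_refs
  obtain ⟨r1, r2, r3, r4, r5⟩ := m4k4_reduce_zeta Z4 C1 Z3 hZ4d hZ4i hC1d hC1i hZ3d hZ3i
  obtain ⟨-, -, r8, r9⟩ := m4k4_reduce_log Z4 C1 Z3 hZ4d hZ4i hC1d hC1i hZ3d hZ3i
  obtain ⟨Zf, hZf⟩ := exists_ptCarrier
  have hZ0 : of (Zf 0) ∈ relations :=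
    pt_zero_mem_relations (Zf 0) (by rw [(hZf 0).2]; push_cast; rfl)
  have hadd : ∀ q q' : ℚ, of (Zf (q + q')) - of (Zf q) - of (Zf q') ∈ relations := fun q q' =>
    pt_add_mem_relations (Zf (q + q')) (Zf q) (Zf q') (hZf _).1 (hZf _).1 (hZf _).1
      (by rw [(hZf _).2]; push_cast; rfl) (hZf _).2 (hZf _).2
  have hred : ∀ c ∈ AddSubgroup.closure
      ({y : FormalRep | ∃ N : IntegralRep 4, N.domain = {x | ∀ i, x i ∈ Set.Ioo (0:ℝ) 1} ∧
        EqOn N.integrand (fun x => 1 / (1 - x 0 * x 1 * x 2 * x 3)) N.domain ∧ y = of N} ∪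
      {y : FormalRep | ∃ N : IntegralRep 4, N.domain = {x | ∀ i, x i ∈ Set.Ioo (0:ℝ) 1} ∧
        EqOn N.integrand (fun x => 1 / (1 + x 0 * x 1 * x 2 * x 3)) N.domain ∧ y = of N} ∪
      {y : FormalRep | ∃ N : IntegralRep 4, N.domain = {x | ∀ i, x i ∈ Set.Ioo (0:ℝ) 1} ∧
        EqOn N.integrand (fun x => 1 / ((1 - x 0 * x 1) * (1 - x 0 * x 1 * x 2 * x 3))) N.domain ∧ y = of N} ∪
      {y : FormalRep | ∃ N : IntegralRep 4, N.domain = {x | ∀ i, x i ∈ Set.Ioo (0:ℝ) 1} ∧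
        EqOn N.integrand (fun x => 1 / ((1 - x 0 * x 1 * x 2) * (1 - x 0 * x 1 * x 2 * x 3))) N.domain ∧ y = of N} ∪
      {y : FormalRep | ∃ N : IntegralRep 4, N.domain = {x | ∀ i, x i ∈ Set.Ioo (0:ℝ) 1} ∧
        EqOn N.integrand (fun x => 1 / ((1 - x 0 * x 1) * (1 - x 2 * x 3))) N.domain ∧ y = of N} ∪
      {y : FormalRep | ∃ N : IntegralRep 4, N.domain = {x | ∀ i, x i ∈ Set.Ioo (0:ℝ) 1} ∧
        EqOn N.integrand (fun x => 1 / ((1 - x 0 * x 1) * (1 + x 2 * x 3))) N.domain ∧ y = of N} ∪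
      {y : FormalRep | ∃ N : IntegralRep 4, N.domain = {x | ∀ i, x i ∈ Set.Ioo (0:ℝ) 1} ∧
        EqOn N.integrand (fun x => 1 / ((1 + x 0 * x 1) * (1 + x 2 * x 3))) N.domain ∧ y = of N} ∪
      {y : FormalRep | ∃ (m : ℕ) (p : MvPolynomial (Fin m) ℚ) (N : IntegralRep m),
        N.domain = {x | ∀ i, x i ∈ Set.Ioo (0:ℝ) 1} ∧
        EqOn N.integrand (fun x => (MvPolynomial.aeval x p : ℝ)) N.domain ∧ y = of N}),
      ∃ (α : ℤ) (q : ℚ), (8:ℕ) • c - (α • of Z4 + of (Zf q)) ∈ relations := by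
    intro c hc
    induction hc using AddSubgroup.closure_induction with
    | mem y hy =>
      simp only [mem_union, mem_setOf_eq] at hy
      rcases hy with (((((((⟨N, hNd, hNi, rfl⟩ | ⟨N, hNd, hNi, rfl⟩) | ⟨N, hNd, hNi, rfl⟩) | ⟨N, hNd, hNi, rfl⟩) | ⟨N, hNd, hNi, rfl⟩) | ⟨N, hNd, hNi, rfl⟩) | ⟨N, hNd, hNi, rfl⟩) | ⟨m, p, N, hNd, hNi, rfl⟩)
      · refine ⟨8, 0, ?_⟩
        have h := r1 N hNd hNi
        have e : (8:ℕ) • of N - ((8:ℤ) • of Z4 + of (Zf 0)) =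
            ((8:ℕ) • of N - ((8:ℤ) • of Z4 + (0:ℤ) • of (C1.prod Z3))) - of (Zf 0) := by
          simp only [zero_smul, add_zero]; abel
        rw [e]
        exact relations.sub_mem h hZ0
      · refine ⟨7, 0, ?_⟩
        have h := r2 N hNd hNi
        have e : (8:ℕ) • of N - ((7:ℤ) • of Z4 + of (Zf 0)) =
            ((8:ℕ) • of N - ((7:ℤ) • of Z4 + (0:ℤ) • of (C1.prod Z3))) - of (Zf 0) := by
          simp only [zero_smul, add_zero]; abel
        rw [e]
        exact relations.sub_mem h hZ0
      · refine ⟨14, 0, ?_⟩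
        have h := r3 N hNd hNi
        have e : (8:ℕ) • of N - ((14:ℤ) • of Z4 + of (Zf 0)) =
            ((8:ℕ) • of N - ((14:ℤ) • of Z4 + (0:ℤ) • of (C1.prod Z3))) - of (Zf 0) := by
          simp only [zero_smul, add_zero]; abel
        rw [e]
        exact relations.sub_mem h hZ0
      · refine ⟨10, 0, ?_⟩
        have h := r4 N hNd hNi
        have e : (8:ℕ) • of N - ((10:ℤ) • of Z4 + of (Zf 0)) =
            ((8:ℕ) • of N - ((10:ℤ) • of Z4 + (0:ℤ) • of (C1.prod Z3))) - of (Zf 0) := by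
          simp only [zero_smul, add_zero]; abel
        rw [e]
        exact relations.sub_mem h hZ0
      · refine ⟨20, 0, ?_⟩
        have h := r5 N hNd hNi
        have e : (8:ℕ) • of N - ((20:ℤ) • of Z4 + of (Zf 0)) =
            ((8:ℕ) • of N - ((20:ℤ) • of Z4 + (0:ℤ) • of (C1.prod Z3))) - of (Zf 0) := by
          simp only [zero_smul, add_zero]; abel
        rw [e]
        exact relations.sub_mem h hZ0
      · refine ⟨10, 0, ?_⟩
        have h := r8 N hNd hNi
        have e : (8:ℕ) • of N - ((10:ℤ) • of Z4 + of (Zf 0)) =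
            ((8:ℕ) • of N - ((10:ℤ) • of Z4 + (0:ℤ) • of (C1.prod Z3))) - of (Zf 0) := by
          simp only [zero_smul, add_zero]; abel
        rw [e]
        exact relations.sub_mem h hZ0
      · refine ⟨5, 0, ?_⟩
        have h := r9 N hNd hNi
        have e : (8:ℕ) • of N - ((5:ℤ) • of Z4 + of (Zf 0)) =
            ((8:ℕ) • of N - ((5:ℤ) • of Z4 + (0:ℤ) • of (C1.prod Z3))) - of (Zf 0) := by
          simp only [zero_smul, add_zero]; abel
        rw [e]
        exact relations.sub_mem h hZ0
      · obtain ⟨q, hq⟩ := boxPoly_exists_pt p N hNd hNi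
        refine ⟨0, 8 * q, ?_⟩
        have h := hq (Zf q) (hZf q).1 (hZf q).2
        have h8 : (8:ℕ) • of (Zf q) - of (Zf (8 * q)) ∈ relations := by
          have h := aff_orbit_of_sub_sum_zsmul_mem_relations (Finset.univ : Finset (Fin 1))
            ![Zf q] ![8] (Zf (8 * q)) (fun i _ => by
              fin_cases i; exact (hZf q).1.trans (hZf _).1.symm) fun x _ => by
              rw [(hZf _).2]
              simp only [Finset.univ_unique, Fin.default_eq_zero, Finset.sum_singleton,
                Matrix.cons_val_fin_one, (hZf q).2]
              push_cast; ring
          have e : (8:ℕ) • of (Zf q) - of (Zf (8 * q)) =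
              -(of (Zf (8 * q)) - ∑ i ∈ (Finset.univ : Finset (Fin 1)), (![(8:ℤ)] i) • of (![Zf q] i)) := by
            simp only [Finset.univ_unique, Fin.default_eq_zero, Finset.sum_singleton,
              Matrix.cons_val_fin_one]
            abel
          rw [e]
          exact relations.neg_mem h
        have e : (8:ℕ) • of N - ((0:ℤ) • of Z4 + of (Zf (8 * q))) =
            (8:ℕ) • (of N - of (Zf q)) + ((8:ℕ) • of (Zf q) - of (Zf (8 * q))) := by
          simp only [zero_smul, zero_add, smul_sub]; abel
        rw [e]
        exact relations.add_mem (relations.nsmul_mem h 8) h8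
    | zero =>
      refine ⟨0, 0, ?_⟩
      have e : (8:ℕ) • (0:FormalRep) - ((0:ℤ) • of Z4 + of (Zf 0)) = -of (Zf 0) := by
        simp only [smul_zero, zero_smul, zero_add, zero_sub]
      rw [e]
      exact relations.neg_mem hZ0
    | add y z _ _ ihy ihz =>
      obtain ⟨α₁, q₁, h₁⟩ := ihy
      obtain ⟨α₂, q₂, h₂⟩ := ihz
      refine ⟨α₁ + α₂, q₁ + q₂, ?_⟩
      have e : (8:ℕ) • (y + z) - ((α₁ + α₂) • of Z4 + of (Zf (q₁ + q₂))) =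
          ((8:ℕ) • y - (α₁ • of Z4 + of (Zf q₁))) + ((8:ℕ) • z - (α₂ • of Z4 + of (Zf q₂))) -
            (of (Zf (q₁ + q₂)) - of (Zf q₁) - of (Zf q₂)) := by
        simp only [smul_add, add_smul]; abel
      rw [e]
      exact relations.sub_mem (relations.add_mem h₁ h₂) (hadd q₁ q₂)
    | neg y _ ih =>
      obtain ⟨α, q, h⟩ := ih
      refine ⟨-α, -q, ?_⟩
      have hq0 : of (Zf (q + -q)) ∈ relations :=
        pt_zero_mem_relations _ (by rw [(hZf _).2]; push_cast; ring_nf)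
      have e : (8:ℕ) • (-y) - ((-α) • of Z4 + of (Zf (-q))) =
          -((8:ℕ) • y - (α • of Z4 + of (Zf q))) + (of (Zf (q + -q)) - of (Zf q) - of (Zf (-q)))
            - of (Zf (q + -q)) := by
        simp only [smul_neg, neg_smul]; abel
      rw [e]
      exact relations.sub_mem (relations.add_mem (relations.neg_mem h) (hadd q (-q))) hq0
  obtain ⟨α, q, h⟩ := hred c hc
  have hev := relations_le_ker_eval_holds h
  rw [AddMonoidHom.mem_ker, map_sub, map_nsmul, map_add, map_zsmul, eval_of, eval_of, hv, hZ4v,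
    m4l4_zetaValue_four, value_pt (Zf q) (hZf q).1 (hZf q).2, smul_zero, zero_sub, neg_eq_zero,
    zsmul_eq_mul] at hev
  obtain rfl := m4l4_eq_zero_of_mul_pi_pow_four α q hev
  have hq : q = 0 := by
    have : (q : ℝ) = 0 := by simpa using hev
    exact_mod_cast this
  subst hq
  have e : (8:ℕ) • c = ((8:ℕ) • c - ((0:ℤ) • of Z4 + of (Zf 0))) + of (Zf 0) := by
    simp only [zero_smul, zero_add]; abel
  refine mem_relations_of_nsmul_mem (by norm_num : 0 < 8) ?_
  rw [e]
  exact relations.add_mem h hZ0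

end Summit.KontsevichZagierPeriods.HurwitzMicroSectors.NormalFormPrinciple.PiBox.M3
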